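/-
Copyright: statement-level skeleton of a published paper (lit-balaban cell, Phase-2 proof seat p39 gen 5). No proof claims
beyond what the kernel checks below.
-/
import Literature.MathematicalPhysics.QuantumFieldTheory.Balaban1983to89.B3Ineq210ZeroBox

/-!
# B3 — T. Bałaban, *(Higgs)₂,₃ quantum fields in a finite volume. III. Renormalization*, CMP **88** (1983) 411–445
[Balaban1983Higgs3], p. 437 [PDF 27]: the printed inequality **|G^ξ_{j″}(0; y, y′)| ≦ O(1)e^{−δ₀|y−y′|}/|y − y′|** *"and the
corresponding inequalities for derivatives"* — PROVED FOR THE ZERO-FIELD BOX PROPAGATOR `G_k(□, 0) = (−Δ^{η,N}_□ + m² + a_kP_k)^{−1}`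
by SUMMING THE SCALE PIECES (2.6)/(2.10) OVER THE SCALES; and the p. 438 [PDF 28] sentence *"ηG_k(x,x) is convergent to some
finite constant as η → 0"* — its BOUNDEDNESS half, for the same propagator

statement-level skeleton of published theorems with citation tags; proofs where landed; nothing here is a claim about
the Yang–Mills mass gap

PDF held: `paper:balaban1983-higgs-2-3-quantum-fields-finite-volume` (journal page = PDF page + 410); pp. 437–438 [PDF 27–28] read
in the OCR text (`p0027.txt`, `p0028.txt`); p. 426 (2.10) as quoted by `B3Ineq210ZeroBox`.
WHAT IS REPRODUCED: members of rows **B3.Eq3.11-3.17** (the p. 437 sentence *"Using the inequalities |C^ξ(y − y′)| ≦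
O(1)e^{−½|y−y′|}/|y − y′|, |G^ξ_{j″}(0; y, y′)| ≦ O(1)e^{−δ₀|y−y′|}/|y − y′|, and the corresponding inequalities for derivatives,
we can estimate (3.16) by a constant"* — here the `G^ξ_{j″}(0)`-inequalities; the `C^ξ`-inequalities are this seat's gens 3–5 and
p03 g3) and **B3.Eq3.21-3.24** (p. 438, *"The expression corresponding to the first graph is in fact convergent, because ηG_k(x,x)
is convergent to some finite constant as η → 0"* — boundedness) of `HOME/lit-balaban-r15/ROWS-B3.md` (fold owner r15), for the
MODEL INSTANCE `A = B̃ = 0`, `Ω = □` a rectangular parallelepiped (p03 g4's `B3Ineq210ZeroBox`, whose objects are used BY NAME: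
the scale pieces `piece ℓ k M j a m2` = `G^η_{(j)}(□, 0)` of (2.6), `sum_piece_eq_inv` : `Σ_{j<k} G^η_{(j)} = G_k(□, 0) =
(B4BoxCov237.boxOpR (L^k) a_k m² M)⁻¹` (values/counting normalisation of the B4 lineage), and the PROVED (2.10) bounds
`abs_piece_le` / `abs_pieceDiff_le`: `|G^η_{(j)}(x,x′)| ≤ C·(b_j^{d+1})⁻¹(s_j²)⁻¹e^{−δ₁|x−x′|_∞/b_j}`, `L^k|G^η_{(j)}(x+e_μ,x′) −
G^η_{(j)}(x,x′)| ≤ C·(b_j^{d+1})⁻¹(s_j)⁻¹e^{−δ₁|x−x′|_∞/b_j}`, `b_j = L^j`, `s_j = L^{k−j}`, dimension `d + 1`, `η = L^{−k}`).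
The paper writes `G_{j″}(0) = Σ_{j<j″}G_{(j)}(0)` ((2.6) p. 424 at zero field, resummed p. 437) and takes its kernel bound from
[Balaban1982Higgs1] Props. 2.1/2.3 = [Balaban1983RegularityDecay] Theorem; the `|y − y′|^{−(d−2)}` short-distance law is exactly what
the sum over the scales of (2.10) produces.  THIS FILE proves the summation:
* §1 (pure real analysis) **`scaleSum_le`**: for `L > 1`, `δ > 0`, `p ≥ 1`, every `k` and every `n > 0`,
  `Σ_{j<k} (L^j)^{−p}e^{−δn/L^j} ≤ C(L,δ,p)·n^{−p}·e^{−(δ/2)n/L^{k−1}}`, `C = (L/(L−1))e^{δ/2} + p!(δ/2)^{−p}/(1 − e^{−(δ/2)(L−1)})`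
  (split of the scales at `L^j = n`: below, `u^pe^{−δu} ≤ p!(δ/2)^{−p}e^{−δu/2}` and `L^m ≥ 1 + m(L−1)` give a geometric series in
  `e^{−(δ/2)(L−1)}`; above, `u^pe^{−δu} ≤ u` gives a geometric series in `1/L`); `scaleSum_zero_le` (`n = 0`: `≤ 1/(1 − L^{−p})`);
* §2 the algebra `(b_j^{d+1})⁻¹(s_j²)⁻¹ = L^{−2k}(L^j)^{−(d−1)}`, `(b_j^{d+1})⁻¹s_j⁻¹ = L^{−k}(L^j)^{−d}`;
* §3 **`abs_Gk_le`** — VALUE CLAUSE: for `d + 1 ≥ 3` there are `δ, C > 0` (functions of `d`, `L`, the window) with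
  `|G_k(□,0;x,x′)| ≤ C·L^{−2k}·|x−x′|_∞^{−(d−1)}·e^{−δ|x−x′|_∞/L^{k−1}}` for every `k ≥ 1`, window point, box and `x ≠ x′` — in the
  print's `η^{d+1}`-normalisation (`G^η = η^{−(d+1)}G`, `dist = η|x−x′|_∞`): `|G^η_k(□,0;x,x′)| ≤ C·dist^{−(d−1)}·e^{−(Lδ)dist}`
  (`abs_Gk_le_eta`), the printed `O(1)e^{−δ₀|y−y′|}/|y−y′|` for `d + 1 = 3`;
* §4 **`abs_GkDiff_le`** — DERIVATIVE CLAUSE (`d + 1 ≥ 2`): `L^k|G_k(□,0;x+e_μ,x′) − G_k(□,0;x,x′)| ≤ C·L^{−k}·|x−x′|_∞^{−d}·e^{−δ|x−x′|_∞/L^{k−1}}`,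
  i.e. `|(∂^η_μG^η_k)(x,x′)| ≤ C·dist^{−d}·e^{−(Lδ)dist}` (`abs_GkDiff_le_eta`), the printed `1/|y−y′|²` law for `d + 1 = 3`;
* §5 **`abs_Gk_diag_le`** — THE DIAGONAL (p. 438): `|G_k(□,0;x,x)| ≤ C·L^{−2k}/(1 − L^{−(d−1)})`, i.e. `η^{d−1}·G^η_k(□,0;x,x) ≤ C′`
  uniformly in `η = L^{−k}`, `x`, `□` (`eta_pow_mul_Gk_diag_le`; for `d + 1 = 3`: `ηG^η_k(x,x)` BOUNDED — the boundedness half of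
  *"ηG_k(x,x) is convergent to some finite constant"*; convergence itself is not claimed).
HONEST SCOPE: exactly the scope of `B3Ineq210ZeroBox` — `A = B̃ = 0`, `Ω = □` a box of unit blocks with Neumann conditions (not the
torus `T^{(j)}_ξ` on which r15/p20 typed (3.15)/(3.16), not general `Ω`), the forward difference in the row variable along bonds of
`□`, sup norm, existential constants depending on `d`, `L` and the window `[a₋,a₊] × [0,m²₊]`; nothing about `A ≠ 0`
([Balaban1983RegularityDecay] Theorem in general = rows B1.Prop2.1/B4.Thm@573, NOT claimed).  Mathlib + the cited tree file only;
theorems only, no new definitions, no named facts; standard axioms.  Unit `lit-balaban-p39-g5` (Phase-2 proof seat p39, gen 5),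
HOME `run/shared/lean/pub/lit-balaban/`, 2026-08-21.
-/

open scoped BigOperators
open Real Finset

namespace Literature.MathematicalPhysics.QuantumFieldTheory.Balaban1983to89.B3GkZeroBoxPointwise

open B4ContourShift B4Reflection242 B4BoxCov237 B4Thm110ZeroBox B3Ineq210ZeroBox

noncomputable section

/-! ## 1. The sum over the scales: Σ_{j<k} (L^j)^{−p}e^{−δn/L^j} ≤ C·n^{−p}·e^{−(δ/2)n/L^{k−1}} -/

section ScaleSum

variable {L δ : ℝ}

/-- kernel: `u^p e^{−cu} ≤ p!/c^p` for `u ≥ 0`, `c > 0` (from `(cu)^p/p! ≤ e^{cu}`). [folklore] -/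
private theorem pow_mul_exp_neg_le {c u : ℝ} (hc : 0 < c) (hu : 0 ≤ u) (p : ℕ) :
    u ^ p * Real.exp (-(c * u)) ≤ (p.factorial : ℝ) / c ^ p := by
  have h := Real.pow_div_factorial_le_exp (c * u) (by positivity) p
  have hp : (0 : ℝ) < p.factorial := by exact_mod_cast Nat.factorial_pos p
  have hcp : 0 < c ^ p := pow_pos hc p
  rw [div_le_iff₀ hp, mul_pow] at h
  rw [Real.exp_neg, le_div_iff₀ hcp]
  have hE := Real.exp_pos (c * u)
  calc u ^ p * (Real.exp (c * u))⁻¹ * c ^ p = (c ^ p * u ^ p) / Real.exp (c * u) := by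
        field_simp
    _ ≤ (Real.exp (c * u) * p.factorial) / Real.exp (c * u) := by gcongr
    _ = p.factorial := by field_simp

/-- kernel: Bernoulli, `L^m ≥ 1 + m(L − 1)` for `L ≥ 1`. [folklore] -/
private theorem one_add_mul_le_pow' (hL : 1 ≤ L) (m : ℕ) : 1 + m * (L - 1) ≤ L ^ m := by
  have h := one_add_mul_le_pow (show (-2 : ℝ) ≤ L - 1 by linarith) m
  simpa using h

/-- kernel: the variables `u_j = n/L^j` along the scales: `u_j = u_J · L^{J−j}` for `j ≤ J`. [folklore] -/
private theorem u_eq_mul_pow (hL : 0 < L) (n : ℝ) {j J : ℕ} (h : j ≤ J) :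
    n / L ^ j = n / L ^ J * L ^ (J - j) := by
  have hLj : L ^ j ≠ 0 := pow_ne_zero _ hL.ne'
  have hLJ : L ^ J ≠ 0 := pow_ne_zero _ hL.ne'
  rw [div_mul_eq_mul_div, div_eq_div_iff hLj hLJ, mul_assoc, ← pow_add, Nat.sub_add_cancel h]

/-- **Below the crossing** (`L^j ≤ n`, i.e. `u_j = n/L^j ≥ 1`): the terms `u_j^p e^{−δu_j}` are dominated by a geometric series in
`q = e^{−(δ/2)(L−1)}` anchored at the largest such index, whose `u` is still `≥ n/L^{k−1}`:
`Σ_{j<k, L^j ≤ n} u_j^pe^{−δu_j} ≤ p!(δ/2)^{−p}(1 − q)^{−1}·e^{−(δ/2)n/L^{k−1}}`. [folklore] -/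
private theorem sum_low_le (hL : 1 < L) (hδ : 0 < δ) (p k : ℕ) {n : ℝ} (hn : 0 < n) :
    ∑ j ∈ (range k).filter (fun j => L ^ j ≤ n), (n / L ^ j) ^ p * Real.exp (-(δ * (n / L ^ j)))
      ≤ (p.factorial : ℝ) / (δ / 2) ^ p * (1 - Real.exp (-(δ / 2 * (L - 1))))⁻¹ *
          Real.exp (-(δ / 2 * (n / L ^ (k - 1)))) := by
  set A := (range k).filter (fun j => L ^ j ≤ n) with hA
  set q : ℝ := Real.exp (-(δ / 2 * (L - 1))) with hq
  have hL0 : 0 < L := by linarith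
  have hq0 : 0 ≤ q := (Real.exp_pos _).le
  have hq1 : q < 1 := by
    rw [hq]; exact Real.exp_lt_one_iff.2 (by nlinarith)
  have hK0 : 0 ≤ (p.factorial : ℝ) / (δ / 2) ^ p := by positivity
  have hgeo0 : 0 ≤ (1 - q)⁻¹ := inv_nonneg.2 (by linarith)
  by_cases hAe : A = ∅
  · rw [hAe, sum_empty]; positivity
  have hAne : A.Nonempty := nonempty_iff_ne_empty.2 hAe
  set J := A.max' hAne with hJ
  have hJA : J ∈ A := max'_mem A hAne
  have hJk : J < k := mem_range.1 (mem_filter.1 hJA).1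
  have hJn : L ^ J ≤ n := (mem_filter.1 hJA).2
  have huJ : 1 ≤ n / L ^ J := by rw [le_div_iff₀ (pow_pos hL0 J)]; linarith
  -- each term: u_j^p e^{−δu_j} ≤ K e^{−(δ/2)u_J} q^{J−j}
  have hterm : ∀ j ∈ A, (n / L ^ j) ^ p * Real.exp (-(δ * (n / L ^ j)))
      ≤ (p.factorial : ℝ) / (δ / 2) ^ p * Real.exp (-(δ / 2 * (n / L ^ J))) * q ^ (J - j) := by
    intro j hj
    have hjJ : j ≤ J := le_max' A j hj
    have huj0 : 0 ≤ n / L ^ j := by positivity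
    -- split e^{−δu} = e^{−(δ/2)u}·e^{−(δ/2)u}
    have hsplit : Real.exp (-(δ * (n / L ^ j))) = Real.exp (-(δ / 2 * (n / L ^ j))) * Real.exp (-(δ / 2 * (n / L ^ j))) := by
      rw [← Real.exp_add]; ring_nf
    have h1 : (n / L ^ j) ^ p * Real.exp (-(δ / 2 * (n / L ^ j))) ≤ (p.factorial : ℝ) / (δ / 2) ^ p :=
      pow_mul_exp_neg_le (half_pos hδ) huj0 p
    -- u_j ≥ u_J + (J − j)(L − 1)
    have hu : n / L ^ J + (J - j : ℕ) * (L - 1) ≤ n / L ^ j := by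
      rw [u_eq_mul_pow hL0 n hjJ]
      have hB := one_add_mul_le_pow' hL.le (J - j)
      have h0 : 0 ≤ ((J - j : ℕ) : ℝ) * (L - 1) := by
        have : (0 : ℝ) ≤ L - 1 := by linarith
        positivity
      nlinarith
    have h2 : Real.exp (-(δ / 2 * (n / L ^ j))) ≤ Real.exp (-(δ / 2 * (n / L ^ J))) * q ^ (J - j) := by
      rw [hq, ← Real.exp_nat_mul, ← Real.exp_add]
      apply Real.exp_le_exp.2
      nlinarith [hδ]
    calc (n / L ^ j) ^ p * Real.exp (-(δ * (n / L ^ j)))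
        = ((n / L ^ j) ^ p * Real.exp (-(δ / 2 * (n / L ^ j)))) * Real.exp (-(δ / 2 * (n / L ^ j))) := by
          rw [hsplit]; ring
      _ ≤ (p.factorial : ℝ) / (δ / 2) ^ p * (Real.exp (-(δ / 2 * (n / L ^ J))) * q ^ (J - j)) :=
          mul_le_mul h1 h2 (Real.exp_pos _).le hK0
      _ = _ := by ring
  -- the geometric sum Σ_{j∈A} q^{J−j} ≤ Σ_{i≤J} q^i ≤ (1−q)⁻¹
  have hgeo : ∑ j ∈ A, q ^ (J - j) ≤ (1 - q)⁻¹ := by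
    have hsub : A ⊆ range (J + 1) := fun j hj => mem_range.2 (Nat.lt_succ_of_le (le_max' A j hj))
    calc ∑ j ∈ A, q ^ (J - j) ≤ ∑ j ∈ range (J + 1), q ^ (J - j) :=
          sum_le_sum_of_subset_of_nonneg hsub fun j _ _ => pow_nonneg hq0 _
      _ = ∑ i ∈ range (J + 1), q ^ i := by
          have h := sum_range_reflect (fun i => q ^ i) (J + 1)
          simp only [Nat.add_sub_cancel] at h
          exact h
      _ ≤ (1 - q)⁻¹ := by
          have h : ∑ i ∈ Ico 0 (J + 1), q ^ i ≤ q ^ 0 / (1 - q) := geom_sum_Ico_le_of_lt_one hq0 hq1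
          rw [pow_zero, ← range_eq_Ico, one_div] at h
          exact h
  -- e^{−(δ/2)u_J} ≤ e^{−(δ/2)n/L^{k−1}}
  have hJexp : Real.exp (-(δ / 2 * (n / L ^ J))) ≤ Real.exp (-(δ / 2 * (n / L ^ (k - 1)))) := by
    apply Real.exp_le_exp.2
    have hpow : L ^ J ≤ L ^ (k - 1) := pow_le_pow_right₀ hL.le (by omega)
    have hdiv : n / L ^ (k - 1) ≤ n / L ^ J := div_le_div_of_nonneg_left hn.le (pow_pos hL0 J) hpow
    nlinarith
  calc ∑ j ∈ A, (n / L ^ j) ^ p * Real.exp (-(δ * (n / L ^ j)))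
      ≤ ∑ j ∈ A, (p.factorial : ℝ) / (δ / 2) ^ p * Real.exp (-(δ / 2 * (n / L ^ J))) * q ^ (J - j) := sum_le_sum hterm
    _ = (p.factorial : ℝ) / (δ / 2) ^ p * Real.exp (-(δ / 2 * (n / L ^ J))) * ∑ j ∈ A, q ^ (J - j) := by
        rw [mul_sum]
    _ ≤ (p.factorial : ℝ) / (δ / 2) ^ p * Real.exp (-(δ / 2 * (n / L ^ (k - 1)))) * (1 - q)⁻¹ := by
        gcongr
    _ = _ := by ring

/-- **Above the crossing** (`n < L^j`, i.e. `u_j < 1`): `u_j^pe^{−δu_j} ≤ u_j` (`p ≥ 1`) and the `u_j` form a geometric sequence of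
ratio `1/L` below `1`: `Σ_{j<k, n<L^j} u_j^pe^{−δu_j} ≤ L/(L−1)`; the sum is EMPTY unless `n < L^{k−1}`. [folklore] -/
private theorem sum_high_le (hL : 1 < L) (hδ : 0 < δ) {p : ℕ} (hp : 1 ≤ p) (k : ℕ) {n : ℝ} (hn : 0 < n) :
    ∑ j ∈ (range k).filter (fun j => ¬ L ^ j ≤ n), (n / L ^ j) ^ p * Real.exp (-(δ * (n / L ^ j)))
      ≤ L / (L - 1) * Real.exp (δ / 2) * Real.exp (-(δ / 2 * (n / L ^ (k - 1)))) := by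
  set B := (range k).filter (fun j => ¬ L ^ j ≤ n) with hB
  have hL0 : 0 < L := by linarith
  have hL1 : 0 < L - 1 := by linarith
  by_cases hBe : B = ∅
  · rw [hBe, sum_empty]; positivity
  have hBne : B.Nonempty := nonempty_iff_ne_empty.2 hBe
  set J := B.min' hBne with hJ
  have hJB : J ∈ B := min'_mem B hBne
  have hJk : J < k := mem_range.1 (mem_filter.1 hJB).1
  have hJn : n < L ^ J := not_le.1 (mem_filter.1 hJB).2
  have huJ : n / L ^ J < 1 := by rw [div_lt_one (pow_pos hL0 J)]; exact hJn
  -- each term ≤ u_j ≤ (1/L)^{j−J}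
  have hterm : ∀ j ∈ B, (n / L ^ j) ^ p * Real.exp (-(δ * (n / L ^ j))) ≤ (L⁻¹) ^ (j - J) := by
    intro j hj
    have hJj : J ≤ j := min'_le B j hj
    have hjn : n < L ^ j := not_le.1 (mem_filter.1 hj).2
    have huj0 : 0 ≤ n / L ^ j := by positivity
    have huj1 : n / L ^ j ≤ 1 := by rw [div_le_one (pow_pos hL0 j)]; exact hjn.le
    have h1 : (n / L ^ j) ^ p ≤ n / L ^ j := by
      have := pow_le_pow_of_le_one huj0 huj1 hp
      rwa [pow_one] at this
    have h2 : Real.exp (-(δ * (n / L ^ j))) ≤ 1 := Real.exp_le_one_iff.2 (by nlinarith)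
    have h3 : n / L ^ j = n / L ^ J * (L⁻¹) ^ (j - J) := by
      have hLj : L ^ j ≠ 0 := pow_ne_zero _ hL0.ne'
      have hLJ : L ^ J ≠ 0 := pow_ne_zero _ hL0.ne'
      rw [inv_pow, ← div_eq_mul_inv, div_div, ← pow_add, Nat.add_sub_cancel' hJj]
    calc (n / L ^ j) ^ p * Real.exp (-(δ * (n / L ^ j))) ≤ (n / L ^ j) * 1 :=
          mul_le_mul h1 h2 (Real.exp_pos _).le huj0
      _ = n / L ^ J * (L⁻¹) ^ (j - J) := by rw [mul_one, h3]
      _ ≤ 1 * (L⁻¹) ^ (j - J) := by gcongr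
      _ = (L⁻¹) ^ (j - J) := one_mul _
  have hq0 : 0 ≤ L⁻¹ := inv_nonneg.2 hL0.le
  have hq1 : L⁻¹ < 1 := inv_lt_one_of_one_lt₀ hL
  have hgeo : ∑ j ∈ B, (L⁻¹) ^ (j - J) ≤ L / (L - 1) := by
    have hsub : B ⊆ Ico J k := fun j hj => mem_Ico.2 ⟨min'_le B j hj, mem_range.1 (mem_filter.1 hj).1⟩
    calc ∑ j ∈ B, (L⁻¹) ^ (j - J) ≤ ∑ j ∈ Ico J k, (L⁻¹) ^ (j - J) :=
          sum_le_sum_of_subset_of_nonneg hsub fun j _ _ => pow_nonneg hq0 _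
      _ = ∑ i ∈ range (k - J), (L⁻¹) ^ i := by
          rw [sum_Ico_eq_sum_range]
          exact sum_congr rfl fun i _ => by rw [Nat.add_sub_cancel_left]
      _ ≤ (L⁻¹) ^ 0 / (1 - L⁻¹) := by
          have h : ∑ i ∈ Ico 0 (k - J), (L⁻¹) ^ i ≤ (L⁻¹) ^ 0 / (1 - L⁻¹) := geom_sum_Ico_le_of_lt_one hq0 hq1
          rwa [← range_eq_Ico] at h
      _ = L / (L - 1) := by
          rw [pow_zero]
          field_simp
  -- the decay factor costs at most e^{δ/2}: B ≠ ∅ forces n < L^J ≤ L^{k−1}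
  have hexp : 1 ≤ Real.exp (δ / 2) * Real.exp (-(δ / 2 * (n / L ^ (k - 1)))) := by
    rw [← Real.exp_add]
    apply Real.one_le_exp_iff.2
    have hpow : L ^ J ≤ L ^ (k - 1) := pow_le_pow_right₀ hL.le (by omega)
    have h1 : n / L ^ (k - 1) ≤ 1 := by
      rw [div_le_one (pow_pos hL0 _)]; linarith
    nlinarith
  calc ∑ j ∈ B, (n / L ^ j) ^ p * Real.exp (-(δ * (n / L ^ j))) ≤ ∑ j ∈ B, (L⁻¹) ^ (j - J) := sum_le_sum hterm
    _ ≤ L / (L - 1) := hgeo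
    _ ≤ L / (L - 1) * (Real.exp (δ / 2) * Real.exp (-(δ / 2 * (n / L ^ (k - 1))))) :=
        le_mul_of_one_le_right (by positivity) hexp
    _ = _ := by ring

/-- **THE SUM OVER THE SCALES.**  For `L > 1`, `δ > 0`, `p ≥ 1`, every number of scales `k` and every `n > 0`:
`Σ_{j<k} (L^j)^{−p}·e^{−δn/L^j} ≤ C·n^{−p}·e^{−(δ/2)n/L^{k−1}}` with
`C = (L/(L−1))e^{δ/2} + p!(δ/2)^{−p}(1 − e^{−(δ/2)(L−1)})^{−1}` — the mechanism behind the `|y − y′|^{−(d−2)}e^{−δ₀|y−y′|}` law of a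
propagator written as a sum of `k` scale pieces each bounded as in (2.10). [cite: Balaban1983Higgs3, (2.10) p.426] -/
theorem scaleSum_le (hL : 1 < L) (hδ : 0 < δ) {p : ℕ} (hp : 1 ≤ p) (k : ℕ) {n : ℝ} (hn : 0 < n) :
    ∑ j ∈ range k, (L ^ j)⁻¹ ^ p * Real.exp (-(δ * n / L ^ j))
      ≤ (L / (L - 1) * Real.exp (δ / 2) + (p.factorial : ℝ) / (δ / 2) ^ p * (1 - Real.exp (-(δ / 2 * (L - 1))))⁻¹)
          * n⁻¹ ^ p * Real.exp (-(δ / 2 * (n / L ^ (k - 1)))) := by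
  have hL0 : 0 < L := by linarith
  -- (L^j)^{−p} = n^{−p}·u_j^p
  have hre : ∀ j, (L ^ j)⁻¹ ^ p * Real.exp (-(δ * n / L ^ j)) = n⁻¹ ^ p * ((n / L ^ j) ^ p * Real.exp (-(δ * (n / L ^ j)))) := by
    intro j
    have hLj : L ^ j ≠ 0 := pow_ne_zero _ hL0.ne'
    rw [mul_div_assoc, ← mul_assoc, ← mul_pow]
    congr 2
    field_simp
  simp_rw [hre]
  rw [← mul_sum, ← sum_filter_add_sum_filter_not (range k) (fun j => L ^ j ≤ n)]
  have h1 := sum_low_le hL hδ p k hn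
  have h2 := sum_high_le hL hδ hp k hn
  have hn0 : 0 ≤ n⁻¹ ^ p := by positivity
  calc n⁻¹ ^ p * (∑ j ∈ (range k).filter (fun j => L ^ j ≤ n), (n / L ^ j) ^ p * Real.exp (-(δ * (n / L ^ j))) +
        ∑ j ∈ (range k).filter (fun j => ¬ L ^ j ≤ n), (n / L ^ j) ^ p * Real.exp (-(δ * (n / L ^ j))))
      ≤ n⁻¹ ^ p * ((p.factorial : ℝ) / (δ / 2) ^ p * (1 - Real.exp (-(δ / 2 * (L - 1))))⁻¹ *
          Real.exp (-(δ / 2 * (n / L ^ (k - 1)))) + L / (L - 1) * Real.exp (δ / 2) * Real.exp (-(δ / 2 * (n / L ^ (k - 1))))) :=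
        mul_le_mul_of_nonneg_left (add_le_add h1 h2) hn0
    _ = _ := by ring

/-- The scale sum AT `n = 0` (the diagonal): `Σ_{j<k} (L^j)^{−p} ≤ (1 − L^{−p})^{−1}` for `L > 1`, `p ≥ 1`.
[cite: Balaban1983Higgs3, (2.10) p.426] -/
theorem scaleSum_zero_le (hL : 1 < L) {p : ℕ} (hp : 1 ≤ p) (k : ℕ) :
    ∑ j ∈ range k, (L ^ j)⁻¹ ^ p ≤ (1 - (L ^ p)⁻¹)⁻¹ := by
  have hL0 : 0 < L := by linarith
  have hq0 : 0 ≤ (L ^ p)⁻¹ := by positivity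
  have hq1 : (L ^ p)⁻¹ < 1 := inv_lt_one_of_one_lt₀ (one_lt_pow₀ hL (by omega))
  have hre : ∀ j, (L ^ j)⁻¹ ^ p = ((L ^ p)⁻¹) ^ j := by
    intro j; rw [← inv_pow, ← inv_pow, ← pow_mul, ← pow_mul, mul_comm]
  simp_rw [hre]
  have h : ∑ i ∈ Ico 0 k, ((L ^ p)⁻¹) ^ i ≤ ((L ^ p)⁻¹) ^ 0 / (1 - (L ^ p)⁻¹) :=
    geom_sum_Ico_le_of_lt_one hq0 hq1
  rw [pow_zero, ← range_eq_Ico, one_div] at h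
  exact h

end ScaleSum

/-! ## 2. The scale factors of the pieces: (b_j^{d+1})⁻¹(s_j²)⁻¹ = L^{−2k}(L^j)^{−(d−1)}, (b_j^{d+1})⁻¹s_j⁻¹ = L^{−k}(L^j)^{−d} -/

section Factors

variable {d : ℕ}

/-- kernel: for `j ≤ k` and `d ≥ 1`, `(b_j^{d+1})⁻¹·(s_j²)⁻¹ = (L^k)^{−2}·((L^j)⁻¹)^{d−1}` (`b_j = L^j`, `s_j = L^{k−j}`).
[cite: Balaban1983Higgs3, (2.10) p.426] -/
theorem factor_value_eq {ℓ k j : ℕ} (hd : 1 ≤ d) (hj : j ≤ k) :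
    (((bj ℓ j : ℕ) : ℝ) ^ (d + 1))⁻¹ * (sc ℓ k j ^ 2)⁻¹
      = ((((ℓ : ℝ) + 1) ^ k) ^ 2)⁻¹ * ((((ℓ : ℝ) + 1) ^ j)⁻¹) ^ (d - 1) := by
  have hL : (0 : ℝ) < (ℓ : ℝ) + 1 := by positivity
  have h := sc_mul_bj (ℓ := ℓ) hj
  rw [bj_cast] at h
  rw [bj_cast]
  have hs : sc ℓ k j ≠ 0 := (sc_pos ℓ k j).ne'
  have hLj : ((ℓ : ℝ) + 1) ^ j ≠ 0 := pow_ne_zero _ hL.ne'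
  obtain ⟨e, rfl⟩ : ∃ e, d = e + 1 := ⟨d - 1, by omega⟩
  simp only [Nat.add_sub_cancel]
  -- L^k = s_j·L^j
  rw [inv_pow, ← h]
  field_simp
  ring

/-- kernel: for `j ≤ k`, `(b_j^{d+1})⁻¹·s_j⁻¹ = (L^k)⁻¹·((L^j)⁻¹)^{d}`. [cite: Balaban1983Higgs3, (2.10) p.426] -/
theorem factor_deriv_eq {ℓ k j : ℕ} (hj : j ≤ k) :
    (((bj ℓ j : ℕ) : ℝ) ^ (d + 1))⁻¹ * (sc ℓ k j)⁻¹
      = ((((ℓ : ℝ) + 1) ^ k))⁻¹ * ((((ℓ : ℝ) + 1) ^ j)⁻¹) ^ d := by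
  have hL : (0 : ℝ) < (ℓ : ℝ) + 1 := by positivity
  have h := sc_mul_bj (ℓ := ℓ) hj
  rw [bj_cast] at h
  have hs : sc ℓ k j ≠ 0 := (sc_pos ℓ k j).ne'
  have hLj : ((ℓ : ℝ) + 1) ^ j ≠ 0 := pow_ne_zero _ hL.ne'
  rw [bj_cast, inv_pow, ← h]
  field_simp
  ring

/-- kernel: a non-zero integer vector has `|σ|_∞ ≥ 1`. [folklore] -/
private theorem one_le_supNorm' {σ : Fin (d + 1) → ℤ} (hσ0 : σ ≠ 0) : 1 ≤ supNorm σ := by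
  obtain ⟨i, hi⟩ := Function.ne_iff.mp hσ0
  have h1 : (1 : ℤ) ≤ |σ i| := Int.one_le_abs hi
  have h2 : ((1 : ℤ) : ℝ) ≤ ((|σ i| : ℤ) : ℝ) := by exact_mod_cast h1
  simpa using h2.trans (abs_le_supNorm σ i)

end Factors

/-! ## 3. The value clause: |G_k(□,0;x,x′)| ≤ C·L^{−2k}·|x−x′|_∞^{−(d−1)}·e^{−δ|x−x′|_∞/L^{k−1}} -/

section Value

variable {d : ℕ}

/-- **[Balaban1983Higgs3] p. 437, |G^ξ_{j″}(0; y, y′)| ≦ O(1)e^{−δ₀|y−y′|}/|y − y′| — PROVED FOR THE ZERO-FIELD BOX PROPAGATOR**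
(counting normalisation of the B4 lineage; `d + 1 ≥ 3`): there are `δ > 0`, `C > 0` depending only on `d`, `L = ℓ + 1 ≥ 2` and
the window `[a₋,a₊] × [0,m²₊]` such that for every scale `k ≥ 1` (`η = L^{−k}`), every window point, every box `□ = Π_μ[0,M_μ)`
and all fine sites `x ≠ x′`:
`|G_k(□,0;x,x′)| = |Σ_{j<k}G^η_{(j)}(x,x′)| ≤ C·(L^k)^{−2}·(|x−x′|_∞)^{−(d−1)}·e^{−(δ/2)|x−x′|_∞/L^{k−1}}`
(`G_k(□,0) = (−Δ^{η,N}_□ + m² + a_kP_k)^{−1} = (boxOpR (L^k) a_k m² M)⁻¹`, p03's `sum_piece_eq_inv`; the pieces bounded by (2.10),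
`abs_piece_le`, summed by `scaleSum_le`). [cite: Balaban1983Higgs3, (3.16) p.437] -/
theorem abs_Gk_le (d ℓ : ℕ) (hd : 2 ≤ d) (hℓ : 1 ≤ ℓ) (amin aplus m2plus : ℝ) (ha : 0 < amin) :
    ∃ δ C : ℝ, 0 < δ ∧ 0 < C ∧ ∀ (k : ℕ), 1 ≤ k → ∀ (a m2 : ℝ), amin ≤ a → a ≤ aplus → 0 ≤ m2 → m2 ≤ m2plus →
      ∀ (M : Fin (d + 1) → ℕ), (∀ i, 1 ≤ M i) → ∀ (x x' : ↥(boxDom (Nf ℓ k M))), x.1 ≠ x'.1 →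
        |(boxOpR ((ℓ + 1) ^ k) (B1.aSeq a ((ℓ : ℝ) + 1) k) m2 M)⁻¹ x x'|
          ≤ C * ((((ℓ : ℝ) + 1) ^ k) ^ 2)⁻¹ * (supNorm (x.1 - x'.1))⁻¹ ^ (d - 1) *
              Real.exp (-(δ / 2 * (supNorm (x.1 - x'.1) / ((ℓ : ℝ) + 1) ^ (k - 1)))) := by
  obtain ⟨δ₁, C, hδ₁, hC, hP⟩ := abs_piece_le d ℓ hℓ amin aplus m2plus ha
  set L : ℝ := (ℓ : ℝ) + 1 with hLdef
  have hL : 1 < L := one_lt_L_real hℓ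
  have hL0 : 0 < L := by linarith
  set Cs : ℝ := L / (L - 1) * Real.exp (δ₁ / 2) +
      ((d - 1).factorial : ℝ) / (δ₁ / 2) ^ (d - 1) * (1 - Real.exp (-(δ₁ / 2 * (L - 1))))⁻¹ with hCs
  have hCs0 : 0 < Cs := by
    have h1 : 0 < L / (L - 1) * Real.exp (δ₁ / 2) := by
      have : 0 < L - 1 := by linarith
      positivity
    have h2 : 0 ≤ ((d - 1).factorial : ℝ) / (δ₁ / 2) ^ (d - 1) * (1 - Real.exp (-(δ₁ / 2 * (L - 1))))⁻¹ := by
      have : 0 < 1 - Real.exp (-(δ₁ / 2 * (L - 1))) := by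
        have : Real.exp (-(δ₁ / 2 * (L - 1))) < 1 := Real.exp_lt_one_iff.2 (by nlinarith)
        linarith
      positivity
    linarith
  refine ⟨δ₁, C * Cs, hδ₁, mul_pos hC hCs0, ?_⟩
  intro k hk a m2 h1 h2 h3 h4 M hM x x' hxx'
  have hn : 1 ≤ supNorm (x.1 - x'.1) := one_le_supNorm' (sub_ne_zero.2 hxx')
  have hn0 : 0 < supNorm (x.1 - x'.1) := by linarith
  set n := supNorm (x.1 - x'.1) with hndef
  rw [← sum_piece_eq_inv hk, Matrix.sum_apply]
  have hd1 : 1 ≤ d - 1 := by omega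
  have hS := scaleSum_le hL hδ₁ hd1 k hn0
  calc |∑ j ∈ range k, piece ℓ k M j a m2 x x'| ≤ ∑ j ∈ range k, |piece ℓ k M j a m2 x x'| := abs_sum_le_sum_abs _ _
    _ ≤ ∑ j ∈ range k, C * ((((bj ℓ j : ℕ) : ℝ) ^ (d + 1))⁻¹ * (sc ℓ k j ^ 2)⁻¹) *
          Real.exp (-(δ₁ * n / ((bj ℓ j : ℕ) : ℝ))) := by
        refine sum_le_sum fun j hj => ?_
        have h := hP k hk j (mem_range.1 hj) a m2 h1 h2 h3 h4 M hM x x'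
        rwa [mul_div_assoc] at h ⊢
    _ = C * ((L ^ k) ^ 2)⁻¹ * ∑ j ∈ range k, (L ^ j)⁻¹ ^ (d - 1) * Real.exp (-(δ₁ * n / L ^ j)) := by
        rw [mul_sum]
        refine sum_congr rfl fun j hj => ?_
        rw [factor_value_eq (by omega) (mem_range.1 hj).le, bj_cast]
        ring
    _ ≤ C * ((L ^ k) ^ 2)⁻¹ * (Cs * n⁻¹ ^ (d - 1) * Real.exp (-(δ₁ / 2 * (n / L ^ (k - 1))))) :=
        mul_le_mul_of_nonneg_left hS (by positivity)
    _ = _ := by ring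

/-- **The value clause in the print's `η^{d+1}`-normalisation** (`G^η_k(x,x′) = η^{−(d+1)}G_k(x,x′)`, `η = L^{−k}`, `dist(x,x′) =
η|x−x′|_∞`): `|G^η_k(□,0;x,x′)| ≤ C·dist^{−(d−1)}·e^{−(Lδ/2)·dist}` for `x ≠ x′` — for `d + 1 = 3` exactly the printed
`O(1)e^{−δ₀|y−y′|}/|y − y′|`. [cite: Balaban1983Higgs3, (3.16) p.437] -/
theorem abs_Gk_le_eta (d ℓ : ℕ) (hd : 2 ≤ d) (hℓ : 1 ≤ ℓ) (amin aplus m2plus : ℝ) (ha : 0 < amin) :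
    ∃ δ C : ℝ, 0 < δ ∧ 0 < C ∧ ∀ (k : ℕ), 1 ≤ k → ∀ (a m2 : ℝ), amin ≤ a → a ≤ aplus → 0 ≤ m2 → m2 ≤ m2plus →
      ∀ (M : Fin (d + 1) → ℕ), (∀ i, 1 ≤ M i) → ∀ (x x' : ↥(boxDom (Nf ℓ k M))), x.1 ≠ x'.1 →
        (((ℓ : ℝ) + 1) ^ k) ^ (d + 1) * |(boxOpR ((ℓ + 1) ^ k) (B1.aSeq a ((ℓ : ℝ) + 1) k) m2 M)⁻¹ x x'|
          ≤ C * (supNorm (x.1 - x'.1) / ((ℓ : ℝ) + 1) ^ k)⁻¹ ^ (d - 1) *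
              Real.exp (-(δ * (supNorm (x.1 - x'.1) / ((ℓ : ℝ) + 1) ^ k))) := by
  obtain ⟨δ, C, hδ, hC, hG⟩ := abs_Gk_le d ℓ hd hℓ amin aplus m2plus ha
  refine ⟨((ℓ : ℝ) + 1) * δ / 2, C, by positivity, hC, ?_⟩
  intro k hk a m2 h1 h2 h3 h4 M hM x x' hxx'
  have h := hG k hk a m2 h1 h2 h3 h4 M hM x x' hxx'
  set L : ℝ := (ℓ : ℝ) + 1 with hLdef
  have hL0 : 0 < L := by positivity
  have hLk : 0 < L ^ k := pow_pos hL0 k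
  set n := supNorm (x.1 - x'.1) with hndef
  have hn : 1 ≤ n := one_le_supNorm' (sub_ne_zero.2 hxx')
  -- the exponents agree: (δ/2)·n/L^{k−1} = (Lδ/2)·(n/L^k)
  have hexp : Real.exp (-(δ / 2 * (n / L ^ (k - 1)))) = Real.exp (-(L * δ / 2 * (n / L ^ k))) := by
    congr 1
    have hk' : L ^ k = L ^ (k - 1) * L := by rw [← pow_succ, Nat.sub_add_cancel hk]
    rw [hk']
    field_simp
  -- the powers agree: (L^k)^{d+1}·(L^k)^{−2}·n^{−(d−1)} = (n/L^k)^{−(d−1)}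
  obtain ⟨e, rfl⟩ : ∃ e, d = e + 2 := ⟨d - 2, by omega⟩
  have hpow : (L ^ k) ^ (e + 2 + 1) * (((L ^ k) ^ 2)⁻¹ * n⁻¹ ^ (e + 2 - 1)) = (n / L ^ k)⁻¹ ^ (e + 2 - 1) := by
    simp only [show e + 2 - 1 = e + 1 from rfl]
    have hn0 : n ≠ 0 := by linarith
    field_simp
    ring
  calc (L ^ k) ^ (e + 2 + 1) * |(boxOpR ((ℓ + 1) ^ k) (B1.aSeq a L k) m2 M)⁻¹ x x'|
      ≤ (L ^ k) ^ (e + 2 + 1) * (C * ((L ^ k) ^ 2)⁻¹ * n⁻¹ ^ (e + 2 - 1) * Real.exp (-(δ / 2 * (n / L ^ (k - 1))))) :=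
        mul_le_mul_of_nonneg_left h (by positivity)
    _ = C * ((L ^ k) ^ (e + 2 + 1) * (((L ^ k) ^ 2)⁻¹ * n⁻¹ ^ (e + 2 - 1))) * Real.exp (-(δ / 2 * (n / L ^ (k - 1)))) := by
        ring
    _ = C * (n / L ^ k)⁻¹ ^ (e + 2 - 1) * Real.exp (-(L * δ / 2 * (n / L ^ k))) := by rw [hpow, hexp]

end Value

/-! ## 4. The derivative clause: L^k|G_k(□,0;x+e_μ,x′) − G_k(□,0;x,x′)| ≤ C·L^{−k}·|x−x′|_∞^{−d}·e^{−δ|x−x′|_∞/L^{k−1}} -/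

section Deriv

variable {d : ℕ}

/-- **[Balaban1983Higgs3] p. 437, "the corresponding inequalities for derivatives" for `G^ξ_{j″}(0)` — PROVED FOR THE ZERO-FIELD BOX
PROPAGATOR** (counting normalisation; `d + 1 ≥ 2`; forward difference in the row variable along a bond `⟨x, x+ηe_μ⟩ ⊂ □`, `η^{−1} = L^k`):
there are `δ > 0`, `C > 0` (functions of `d`, `L`, the window) such that for every `k ≥ 1`, window point, box, axis `μ` and fine sites
`x ≠ x′`, `x + e_μ ∈ □`:
`L^k·|G_k(□,0;x+e_μ,x′) − G_k(□,0;x,x′)| ≤ C·(L^k)^{−1}·(|x−x′|_∞)^{−d}·e^{−(δ/2)|x−x′|_∞/L^{k−1}}`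
(pieces bounded by the derivative clause of (2.10), `abs_pieceDiff_le`, summed by `scaleSum_le` with `p = d`).
[cite: Balaban1983Higgs3, (3.16) p.437] -/
theorem abs_GkDiff_le (d ℓ : ℕ) (hd : 1 ≤ d) (hℓ : 1 ≤ ℓ) (amin aplus m2plus : ℝ) (ha : 0 < amin) :
    ∃ δ C : ℝ, 0 < δ ∧ 0 < C ∧ ∀ (k : ℕ), 1 ≤ k → ∀ (a m2 : ℝ), amin ≤ a → a ≤ aplus → 0 ≤ m2 → m2 ≤ m2plus →
      ∀ (M : Fin (d + 1) → ℕ), (∀ i, 1 ≤ M i) →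
        ∀ (μ : Fin (d + 1)) (x xe : ↥(boxDom (Nf ℓ k M))), xe.1 = x.1 + Pi.single μ 1 →
        ∀ (x' : ↥(boxDom (Nf ℓ k M))), x.1 ≠ x'.1 →
          ((((ℓ + 1) ^ k : ℕ)) : ℝ) *
            |(boxOpR ((ℓ + 1) ^ k) (B1.aSeq a ((ℓ : ℝ) + 1) k) m2 M)⁻¹ xe x'
              - (boxOpR ((ℓ + 1) ^ k) (B1.aSeq a ((ℓ : ℝ) + 1) k) m2 M)⁻¹ x x'|
          ≤ C * (((ℓ : ℝ) + 1) ^ k)⁻¹ * (supNorm (x.1 - x'.1))⁻¹ ^ d *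
              Real.exp (-(δ / 2 * (supNorm (x.1 - x'.1) / ((ℓ : ℝ) + 1) ^ (k - 1)))) := by
  obtain ⟨δ₁, C, hδ₁, hC, hP⟩ := abs_pieceDiff_le d ℓ hℓ amin aplus m2plus ha
  set L : ℝ := (ℓ : ℝ) + 1 with hLdef
  have hL : 1 < L := one_lt_L_real hℓ
  have hL0 : 0 < L := by linarith
  set Cs : ℝ := L / (L - 1) * Real.exp (δ₁ / 2) +
      (d.factorial : ℝ) / (δ₁ / 2) ^ d * (1 - Real.exp (-(δ₁ / 2 * (L - 1))))⁻¹ with hCs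
  have hCs0 : 0 < Cs := by
    have h1 : 0 < L / (L - 1) * Real.exp (δ₁ / 2) := by
      have : 0 < L - 1 := by linarith
      positivity
    have h2 : 0 ≤ (d.factorial : ℝ) / (δ₁ / 2) ^ d * (1 - Real.exp (-(δ₁ / 2 * (L - 1))))⁻¹ := by
      have : 0 < 1 - Real.exp (-(δ₁ / 2 * (L - 1))) := by
        have : Real.exp (-(δ₁ / 2 * (L - 1))) < 1 := Real.exp_lt_one_iff.2 (by nlinarith)
        linarith
      positivity
    linarith
  refine ⟨δ₁, C * Cs, hδ₁, mul_pos hC hCs0, ?_⟩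
  intro k hk a m2 h1 h2 h3 h4 M hM μ x xe hxe x' hxx'
  have hn : 1 ≤ supNorm (x.1 - x'.1) := one_le_supNorm' (sub_ne_zero.2 hxx')
  have hn0 : 0 < supNorm (x.1 - x'.1) := by linarith
  set n := supNorm (x.1 - x'.1) with hndef
  have hLk : (0 : ℝ) < (((ℓ + 1) ^ k : ℕ) : ℝ) := by positivity
  rw [← sum_piece_eq_inv hk, Matrix.sum_apply, Matrix.sum_apply, ← sum_sub_distrib]
  have hS := scaleSum_le hL hδ₁ hd k hn0
  calc ((((ℓ + 1) ^ k : ℕ)) : ℝ) * |∑ j ∈ range k, (piece ℓ k M j a m2 xe x' - piece ℓ k M j a m2 x x')|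
      ≤ ((((ℓ + 1) ^ k : ℕ)) : ℝ) * ∑ j ∈ range k, |piece ℓ k M j a m2 xe x' - piece ℓ k M j a m2 x x'| :=
        mul_le_mul_of_nonneg_left (abs_sum_le_sum_abs _ _) hLk.le
    _ = ∑ j ∈ range k, ((((ℓ + 1) ^ k : ℕ)) : ℝ) * |piece ℓ k M j a m2 xe x' - piece ℓ k M j a m2 x x'| := by
        rw [mul_sum]
    _ ≤ ∑ j ∈ range k, C * ((((bj ℓ j : ℕ) : ℝ) ^ (d + 1))⁻¹ * (sc ℓ k j)⁻¹) *
          Real.exp (-(δ₁ * n / ((bj ℓ j : ℕ) : ℝ))) := by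
        refine sum_le_sum fun j hj => ?_
        have h := hP k hk j (mem_range.1 hj) a m2 h1 h2 h3 h4 M hM μ x xe hxe x'
        rwa [mul_div_assoc] at h ⊢
    _ = C * (L ^ k)⁻¹ * ∑ j ∈ range k, (L ^ j)⁻¹ ^ d * Real.exp (-(δ₁ * n / L ^ j)) := by
        rw [mul_sum]
        refine sum_congr rfl fun j hj => ?_
        rw [factor_deriv_eq (mem_range.1 hj).le, bj_cast]
        ring
    _ ≤ C * (L ^ k)⁻¹ * (Cs * n⁻¹ ^ d * Real.exp (-(δ₁ / 2 * (n / L ^ (k - 1))))) :=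
        mul_le_mul_of_nonneg_left hS (by positivity)
    _ = _ := by ring

/-- **The derivative clause in the print's normalisation** (`(∂^η_μG^η_k)(x,x′) = η^{−(d+1)}·η^{−1}(G_k(x+e_μ,x′) − G_k(x,x′))`,
`dist = η|x−x′|_∞`): `|(∂^η_μG^η_k(□,0))(x,x′)| ≤ C·dist^{−d}·e^{−(Lδ/2)·dist}` for `x ≠ x′` — for `d + 1 = 3` the `1/|y−y′|²` law of the
differentiated propagator. [cite: Balaban1983Higgs3, (3.16) p.437] -/
theorem abs_GkDiff_le_eta (d ℓ : ℕ) (hd : 1 ≤ d) (hℓ : 1 ≤ ℓ) (amin aplus m2plus : ℝ) (ha : 0 < amin) :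
    ∃ δ C : ℝ, 0 < δ ∧ 0 < C ∧ ∀ (k : ℕ), 1 ≤ k → ∀ (a m2 : ℝ), amin ≤ a → a ≤ aplus → 0 ≤ m2 → m2 ≤ m2plus →
      ∀ (M : Fin (d + 1) → ℕ), (∀ i, 1 ≤ M i) →
        ∀ (μ : Fin (d + 1)) (x xe : ↥(boxDom (Nf ℓ k M))), xe.1 = x.1 + Pi.single μ 1 →
        ∀ (x' : ↥(boxDom (Nf ℓ k M))), x.1 ≠ x'.1 →
          (((ℓ : ℝ) + 1) ^ k) ^ (d + 1) * ((((ℓ : ℝ) + 1) ^ k) *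
            |(boxOpR ((ℓ + 1) ^ k) (B1.aSeq a ((ℓ : ℝ) + 1) k) m2 M)⁻¹ xe x'
              - (boxOpR ((ℓ + 1) ^ k) (B1.aSeq a ((ℓ : ℝ) + 1) k) m2 M)⁻¹ x x'|)
          ≤ C * (supNorm (x.1 - x'.1) / ((ℓ : ℝ) + 1) ^ k)⁻¹ ^ d *
              Real.exp (-(δ * (supNorm (x.1 - x'.1) / ((ℓ : ℝ) + 1) ^ k))) := by
  obtain ⟨δ, C, hδ, hC, hG⟩ := abs_GkDiff_le d ℓ hd hℓ amin aplus m2plus ha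
  refine ⟨((ℓ : ℝ) + 1) * δ / 2, C, by positivity, hC, ?_⟩
  intro k hk a m2 h1 h2 h3 h4 M hM μ x xe hxe x' hxx'
  have h := hG k hk a m2 h1 h2 h3 h4 M hM μ x xe hxe x' hxx'
  set L : ℝ := (ℓ : ℝ) + 1 with hLdef
  have hL0 : 0 < L := by positivity
  have hLk : 0 < L ^ k := pow_pos hL0 k
  have hcast : ((((ℓ + 1) ^ k : ℕ)) : ℝ) = L ^ k := by push_cast; rfl
  rw [hcast] at h
  set n := supNorm (x.1 - x'.1) with hndef
  have hn : 1 ≤ n := one_le_supNorm' (sub_ne_zero.2 hxx')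
  set D := |(boxOpR ((ℓ + 1) ^ k) (B1.aSeq a L k) m2 M)⁻¹ xe x' - (boxOpR ((ℓ + 1) ^ k) (B1.aSeq a L k) m2 M)⁻¹ x x'|
    with hD
  have hexp : Real.exp (-(δ / 2 * (n / L ^ (k - 1)))) = Real.exp (-(L * δ / 2 * (n / L ^ k))) := by
    congr 1
    have hk' : L ^ k = L ^ (k - 1) * L := by rw [← pow_succ, Nat.sub_add_cancel hk]
    rw [hk']
    field_simp
  have hpow : (L ^ k) ^ (d + 1) * ((L ^ k)⁻¹ * n⁻¹ ^ d) = (n / L ^ k)⁻¹ ^ d := by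
    have hn0 : n ≠ 0 := by linarith
    field_simp
    ring
  calc (L ^ k) ^ (d + 1) * (L ^ k * D) ≤ (L ^ k) ^ (d + 1) * (C * (L ^ k)⁻¹ * n⁻¹ ^ d * Real.exp (-(δ / 2 * (n / L ^ (k - 1))))) :=
        mul_le_mul_of_nonneg_left h (by positivity)
    _ = C * ((L ^ k) ^ (d + 1) * ((L ^ k)⁻¹ * n⁻¹ ^ d)) * Real.exp (-(δ / 2 * (n / L ^ (k - 1)))) := by ring
    _ = C * (n / L ^ k)⁻¹ ^ d * Real.exp (-(L * δ / 2 * (n / L ^ k))) := by rw [hpow, hexp]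

end Deriv

/-! ## 5. The diagonal: ηG_k(x,x) is bounded (p. 438) -/

section Diag

variable {d : ℕ}

/-- **The diagonal of the zero-field box propagator** (counting normalisation, `d + 1 ≥ 3`): there is `C > 0` (a function of `d`, `L`,
the window) with `|G_k(□,0;x,x)| ≤ C·(L^k)^{−2}·(1 − L^{−(d−1)})^{−1}` for every `k ≥ 1`, window point, box and site `x` (the pieces at
`x = x′` are bounded by `C(b_j^{d+1})⁻¹(s_j²)⁻¹ = C·L^{−2k}(L^j)^{−(d−1)}`, a geometric series in `L^{−(d−1)}`, `scaleSum_zero_le`).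
[cite: Balaban1983Higgs3, (3.21) p.438] -/
theorem abs_Gk_diag_le (d ℓ : ℕ) (hd : 2 ≤ d) (hℓ : 1 ≤ ℓ) (amin aplus m2plus : ℝ) (ha : 0 < amin) :
    ∃ C : ℝ, 0 < C ∧ ∀ (k : ℕ), 1 ≤ k → ∀ (a m2 : ℝ), amin ≤ a → a ≤ aplus → 0 ≤ m2 → m2 ≤ m2plus →
      ∀ (M : Fin (d + 1) → ℕ), (∀ i, 1 ≤ M i) → ∀ (x : ↥(boxDom (Nf ℓ k M))),
        |(boxOpR ((ℓ + 1) ^ k) (B1.aSeq a ((ℓ : ℝ) + 1) k) m2 M)⁻¹ x x|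
          ≤ C * ((((ℓ : ℝ) + 1) ^ k) ^ 2)⁻¹ * (1 - ((((ℓ : ℝ) + 1) ^ (d - 1)))⁻¹)⁻¹ := by
  obtain ⟨δ₁, C, hδ₁, hC, hP⟩ := abs_piece_le d ℓ hℓ amin aplus m2plus ha
  refine ⟨C, hC, ?_⟩
  intro k hk a m2 h1 h2 h3 h4 M hM x
  set L : ℝ := (ℓ : ℝ) + 1 with hLdef
  have hL : 1 < L := one_lt_L_real hℓ
  have hL0 : 0 < L := by linarith
  rw [← sum_piece_eq_inv hk, Matrix.sum_apply]
  have hd1 : 1 ≤ d - 1 := by omega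
  have hS := scaleSum_zero_le hL hd1 k
  have h0 : supNorm (x.1 - x.1) = 0 := by
    rw [sub_self]
    unfold supNorm
    apply le_antisymm
    · exact Finset.sup'_le _ _ fun i _ => by simp
    · exact le_trans (by simp) (Finset.le_sup' (fun i => ((|(0 : Fin (d + 1) → ℤ) i| : ℤ) : ℝ)) (Finset.mem_univ 0))
  calc |∑ j ∈ range k, piece ℓ k M j a m2 x x| ≤ ∑ j ∈ range k, |piece ℓ k M j a m2 x x| := abs_sum_le_sum_abs _ _
    _ ≤ ∑ j ∈ range k, C * ((((bj ℓ j : ℕ) : ℝ) ^ (d + 1))⁻¹ * (sc ℓ k j ^ 2)⁻¹) := by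
        refine sum_le_sum fun j hj => ?_
        have h := hP k hk j (mem_range.1 hj) a m2 h1 h2 h3 h4 M hM x x
        rw [h0, mul_zero, zero_div, neg_zero, Real.exp_zero, mul_one] at h
        exact h
    _ = C * ((L ^ k) ^ 2)⁻¹ * ∑ j ∈ range k, (L ^ j)⁻¹ ^ (d - 1) := by
        rw [mul_sum]
        refine sum_congr rfl fun j hj => ?_
        rw [factor_value_eq (by omega) (mem_range.1 hj).le]
        ring
    _ ≤ C * ((L ^ k) ^ 2)⁻¹ * (1 - (L ^ (d - 1))⁻¹)⁻¹ := mul_le_mul_of_nonneg_left hS (by positivity)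

/-- **p. 438: "ηG_k(x,x) is convergent to some finite constant as η → 0" — BOUNDEDNESS, for the zero-field box propagator** in the
print's normalisation (`G^η_k = η^{−(d+1)}G_k`, `η = L^{−k}`): `η^{d−1}·G^η_k(□,0;x,x) = (L^k)²·|G_k(□,0;x,x)| ≤ C·(1 − L^{−(d−1)})^{−1}`
uniformly in `k` (i.e. in `η`), in the box and in `x`; for `d + 1 = 3` this is `ηG^η_k(x,x) ≤ O(1)`.  Convergence as `η → 0` is NOT
claimed. [cite: Balaban1983Higgs3, (3.21) p.438] -/
theorem eta_pow_mul_Gk_diag_le (d ℓ : ℕ) (hd : 2 ≤ d) (hℓ : 1 ≤ ℓ) (amin aplus m2plus : ℝ) (ha : 0 < amin) :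
    ∃ C : ℝ, 0 < C ∧ ∀ (k : ℕ), 1 ≤ k → ∀ (a m2 : ℝ), amin ≤ a → a ≤ aplus → 0 ≤ m2 → m2 ≤ m2plus →
      ∀ (M : Fin (d + 1) → ℕ), (∀ i, 1 ≤ M i) → ∀ (x : ↥(boxDom (Nf ℓ k M))),
        (((ℓ : ℝ) + 1) ^ k) ^ 2 * |(boxOpR ((ℓ + 1) ^ k) (B1.aSeq a ((ℓ : ℝ) + 1) k) m2 M)⁻¹ x x|
          ≤ C * (1 - ((((ℓ : ℝ) + 1) ^ (d - 1)))⁻¹)⁻¹ := by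
  obtain ⟨C, hC, hG⟩ := abs_Gk_diag_le d ℓ hd hℓ amin aplus m2plus ha
  refine ⟨C, hC, ?_⟩
  intro k hk a m2 h1 h2 h3 h4 M hM x
  have h := hG k hk a m2 h1 h2 h3 h4 M hM x
  have hL0 : (0 : ℝ) < ((ℓ : ℝ) + 1) ^ k := by positivity
  have hLk2 : (0 : ℝ) < (((ℓ : ℝ) + 1) ^ k) ^ 2 := by positivity
  calc (((ℓ : ℝ) + 1) ^ k) ^ 2 * |(boxOpR ((ℓ + 1) ^ k) (B1.aSeq a ((ℓ : ℝ) + 1) k) m2 M)⁻¹ x x|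
      ≤ (((ℓ : ℝ) + 1) ^ k) ^ 2 * (C * ((((ℓ : ℝ) + 1) ^ k) ^ 2)⁻¹ * (1 - ((((ℓ : ℝ) + 1) ^ (d - 1)))⁻¹)⁻¹) :=
        mul_le_mul_of_nonneg_left h hLk2.le
    _ = C * (1 - ((((ℓ : ℝ) + 1) ^ (d - 1)))⁻¹)⁻¹ := by field_simp

end Diag

end

end Literature.MathematicalPhysics.QuantumFieldTheory.Balaban1983to89.B3GkZeroBoxPointwise
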